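import Summits.QuantumFields.YangMills.Theorems.BalabanUVNodesPortS1JacobianHoloCovDeriv

/-!
# NODE O port PT-A — ROW (d) OF `stub_LZjac` ON ONE TORUS: THE HOLOMORPHIC JACOBIAN FACTOR IS INVARIANT UNDER `SL(2,ℂ)`-VALUED GAUGE TRANSFORMATIONS.  For det-one `u`, an `SL(2,ℂ)`-valued field `W`
# with (0.4) loop matrices in the `1∕3`-polydisc whose transform `W^u = (b ↦ u(b₋)·W(b)·adj u(b₊))` has loop matrices in the unit polydisc: the complex block law
# `A₁^ℂ(c)(W^u) = Ad^ℂ(u(emb c₋)) · A₁^ℂ(c)(W) · Ad^ℂ(adj u(b₀(c)₋))`, hence `det A₁^ℂ(c)(W^u) = det A₁^ℂ(c)(W)` (`det Ad^ℂ = (det)³ = 1`) and `jacFactorC c (W^u) = jacFactorC c W` — [I] (1.19) «for all Gᶜ-valued gauge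
# transformations u» for the Jacobian pieces of `phiLZjac`

Cell `ym-nodeO-ideate`, porter seat `ymgap-nodeO-port-PTA-1` (gen 5); `--supports stmt-QuantumFields-27930` (helper; registered stub `stub_LZjac` of the reshaped skeleton `pta_residueW`, PORT-PLAN-v5 §4∕§6 row (d)).
[I] = [Balaban1987RG1].  CONSUMED BY NAME: ✓p813150 (`fderiv_avgMh_gauge`, `exists_gaugeCLM`), ✓p812912 (`avgMh_gauge`, `adjugate_mul_self_of_det_eq_one`, `self_mul_adjugate_of_det_eq_one`, `adjugate_adjugate_two`),
✓p812756 (`trace_jacResponse_eq_zero`, `sum_su2CoordC_smul_su2Gen`, `su2CoordC_conj_eq_sum`, `su2CoordC_sum_smul`), ✓p812578 (`det_adMatC_of_det_eq_one`), ✓p812392 (`jacBlockC`, `jacFactorC`), ✓p810401 (`trace_su2Gen`),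
Mathlib (`Matrix.mul_inv_rev`, `inv_eq_left_inv`, `det_adjugate`, `trace_mul_cycle`).
THE ARGUMENT.  The transformed block direction `su2Gen a·W^u(β)·δ_β` is the transform of `V = (adj u_β·su2Gen a·u_β·W(β))·δ_β` (`gauge_single`); the response transforms by conjugation (✓p813150), the
average by `g·(·)·adj u₊` (✓p812912) so its inverse by `u₊·(·)⁻¹·adj g`; `V = Σ_{a′} Ad^ℂ(adj u_β)_{a′a} • (su2Gen a′·W(β)·δ_β)` because `adj u_β·su2Gen a·u_β` is traceless (`sum_su2CoordC_smul_su2Gen`); the resulting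
`g·N·adj g` has `N = Σ c_{a′}(response_{a′}·A⁻¹)` traceless (✓p812756), so its complex coordinates are `Ad^ℂ(g)` times those of `N` (`su2CoordC_conj_eq_sum`) — the block law; determinants by ✓p812578.
* `gauge_single`, `single_sum_smul`, `trace_adjugate_mul_mul`, ★★ `jacBlockC_gauge_apply`, ★★ `jacBlockC_gauge`, ★★ `det_jacBlockC_gauge`, ★★ `jacFactorC_gauge`.

HONEST FRAMING.  Algebra ∕ calculus over the tree's holomorphic model; the polydisc conditions at `W` AND at `W^u` and `det = 1` are DISPLAYED hypotheses; NOTHING of Bałaban's estimates asserted, ported or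
discharged; this is row (d) for ONE factor on ONE torus — the integer-lattice packaging (e), rows (a)(b) on the whole (1.11)–(1.16) domain and the `axialize ∘ Ū^k` composition remain; `stub_LZjac` OPEN;
`stub_LZdet` BLOCKED-ON P0 (α)+(β); `stub_FE` XXL; 27930 OPEN · no claim; K0⁷∕K-Ax OPEN; NODE O 0∕1; COUNT 8∕28 · K 1∕4 UNMOVED; finite `𝕋⁴_{L^K}` at fixed ε — NOT continuum ∕ OS ∕ Clay; **the Yang–Mills
mass gap is NOT proved by any of this.**  No `sorry`, no `def`, no `instance`, no `notation`; standard axioms.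
-/

noncomputable section

open scoped BigOperators Matrix.Norms.L2Operator Topology

namespace Summit.QuantumFields.YangMills.Theorems.BalabanUVNodesPortS1

open Summit.QuantumFields.YangMills.Theorems.K0RecordFormatNames
open Literature.MathematicalPhysics.QuantumFieldTheory.Balaban1983to89
open Literature.MathematicalPhysics.QuantumFieldTheory.Balaban1983to89.Node00
open Literature.MathematicalPhysics.QuantumFieldTheory.Balaban1983to89.T4Continuum (T4Family)
open Literature.MathematicalPhysics.QuantumFieldTheory.Balaban1983to89.BlockAveraging (Idx)
open Literature.MathematicalPhysics.QuantumFieldTheory.Balaban1983to89.BlockAveragingHaarAC (centralBond)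
open Literature.MathematicalPhysics.QuantumFieldTheory.Balaban1983to89.B15AveragingHolomorphic
open _root_.Matrix _root_.Filter

variable {P : Params} {j : ℕ}

/-- The action on a single-bond field. [cite: Balaban1987RG1, (1.10) p.262 (bookkeeping)] -/
theorem gauge_single (u : Site P j → MatA 2) (β : PBond P j) (Y : MatA 2) :
    (fun b : PBond P j => u b.src * (Pi.single β Y : PBond P j → MatA 2) b * (u b.tgt).adjugate) = Pi.single β (u β.src * Y * (u β.tgt).adjugate) := by
  classical
  funext b
  by_cases hb : b = β
  · subst hb; simp only [Pi.single_eq_same]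
  · simp only [Pi.single_eq_of_ne hb, mul_zero, zero_mul]

/-- A single-bond field with a combination of values is the combination of single-bond fields. [folklore] -/
theorem single_sum_smul (β : PBond P j) (cf : Fin 3 → ℂ) (N : Fin 3 → MatA 2) :
    (Pi.single β (∑ a, cf a • N a) : PBond P j → MatA 2) = ∑ a, cf a • (Pi.single β (N a) : PBond P j → MatA 2) := by
  classical
  funext b
  rw [Finset.sum_apply]
  by_cases hb : b = β
  · subst hb; simp only [Pi.single_eq_same, Pi.smul_apply]
  · simp only [Pi.single_eq_of_ne hb, Pi.smul_apply, smul_zero, Finset.sum_const_zero]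

/-- `tr(adj u · X · u) = tr X` at determinant one. [folklore] -/
theorem trace_adjugate_mul_mul {u : MatA 2} (hu : u.det = 1) (X : MatA 2) : Matrix.trace (u.adjugate * X * u) = Matrix.trace X := by
  rw [Matrix.trace_mul_cycle, self_mul_adjugate_of_det_eq_one hu, one_mul]

/-- ★★ **THE COMPLEX BLOCK LAW, entrywise**: for det-one `u`, an `SL(2,ℂ)`-valued `W` with loop matrices in the `1∕3`-polydisc whose transform `W^u` has loop matrices in the unit polydisc,
`A₁^ℂ(c)(W^u)_{ia} = Σ_{i′a′} Ad^ℂ(u(emb c₋))_{ii′} · A₁^ℂ(c)(W)_{i′a′} · su2CoordC(adj u_β·su2Gen a·u_β)_{a′}` (`u_β := u(b₀(c)₋)`). [cite: Balaban1987RG1, (2.16) p.269, (1.19) p.263, (1.10) p.262, p.267] -/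
theorem jacBlockC_gauge_apply (u : Site P j → MatA 2) (hu : ∀ x, (u x).det = 1) (W : PBond P j → MatA 2) (hW : ∀ b, (W b).det = 1)
    (h3 : ∀ (c : PBond P (j + 1)) (i : Idx P), ‖loopMh W c i - 1‖ < 1 / 3)
    (h' : ∀ (c : PBond P (j + 1)) (i : Idx P), ‖loopMh (fun b : PBond P j => u b.src * W b * (u b.tgt).adjugate) c i - 1‖ < 1)
    (c : PBond P (j + 1)) (i a : Fin 3) :
    jacBlockC c (fun b : PBond P j => u b.src * W b * (u b.tgt).adjugate) i a =
      ∑ i', ∑ a', su2CoordC (u (emb c.src) * su2Gen i' * (u (emb c.src)).adjugate) i * jacBlockC c W i' a' *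
        su2CoordC ((u (centralBond c).src).adjugate * su2Gen a * u (centralBond c).src) a' := by
  classical
  have h1 : ∀ (c' : PBond P (j + 1)) (i : Idx P), ‖loopMh W c' i - 1‖ < 1 := fun c' i => (h3 c' i).trans (by norm_num)
  -- names
  set β : PBond P j := centralBond c with hβ
  set g : MatA 2 := u (emb c.src) with hg
  set ut : MatA 2 := u (emb c.tgt) with hut
  set ub : MatA 2 := u β.src with hub
  set A : MatA 2 := avgMh W c with hA
  set Dw := fderiv ℂ (avgMh : (PBond P j → MatA 2) → PBond P (j + 1) → MatA 2) W with hDw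
  set cf : Fin 3 → ℂ := fun a' => su2CoordC (ub.adjugate * su2Gen a * ub) a' with hcf
  set TW : PBond P j → MatA 2 := fun b => u b.src * W b * (u b.tgt).adjugate with hTW
  -- (S1) the transformed direction is the transform of `V`
  set V : PBond P j → MatA 2 := Pi.single β (ub.adjugate * su2Gen a * ub * W β) with hV
  have hdir : (Pi.single β (su2Gen a * TW β) : PBond P j → MatA 2) = fun b => u b.src * V b * (u b.tgt).adjugate := by
    rw [hV, gauge_single, ← hub]
    congr 1
    show su2Gen a * (ub * W β * (u β.tgt).adjugate) = ub * (ub.adjugate * su2Gen a * ub * W β) * (u β.tgt).adjugate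
    calc su2Gen a * (ub * W β * (u β.tgt).adjugate) = (ub * ub.adjugate) * su2Gen a * ub * W β * (u β.tgt).adjugate := by
          rw [self_mul_adjugate_of_det_eq_one (hu _), one_mul]; noncomm_ring
      _ = ub * (ub.adjugate * su2Gen a * ub * W β) * (u β.tgt).adjugate := by noncomm_ring
  -- (S2) the response transforms by conjugation
  have hresp : fderiv ℂ (avgMh : (PBond P j → MatA 2) → PBond P (j + 1) → MatA 2) TW (Pi.single β (su2Gen a * TW β)) c = g * Dw V c * ut.adjugate := by
    rw [hdir]
    exact fderiv_avgMh_gauge u hu W h1 h' V c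
  -- (S3) `V` is a combination of the untransformed block directions
  have htr0 : Matrix.trace (ub.adjugate * su2Gen a * ub) = 0 := by rw [trace_adjugate_mul_mul (hu _), trace_su2Gen]
  have hVsum : V = ∑ a', cf a' • (Pi.single β (su2Gen a' * W β) : PBond P j → MatA 2) := by
    rw [hV, ← single_sum_smul]
    congr 1
    rw [← sum_su2CoordC_smul_su2Gen htr0, Finset.sum_mul]
    simp only [Matrix.smul_mul]
    rfl
  have hDV : Dw V c = ∑ a', cf a' • Dw (Pi.single β (su2Gen a' * W β)) c := by
    rw [hVsum, map_sum, Finset.sum_apply]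
    exact Finset.sum_congr rfl fun a' _ => by rw [map_smul, Pi.smul_apply]
  -- (S4) the inverse of the transformed average
  have hAu : avgMh TW c = g * A * ut.adjugate := avgMh_gauge u hu W c
  have hinv : (avgMh TW c)⁻¹ = ut * A⁻¹ * g.adjugate := by
    rw [hAu, Matrix.mul_inv_rev, Matrix.mul_inv_rev,
      Matrix.inv_eq_left_inv (self_mul_adjugate_of_det_eq_one (hu (emb c.tgt))),
      Matrix.inv_eq_left_inv (adjugate_mul_self_of_det_eq_one (hu (emb c.src)))]
    noncomm_ring
  -- (S5)–(S6) the argument of `su2CoordC` is `g · N · adj g` with `N` traceless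
  set N : MatA 2 := ∑ a', cf a' • (Dw (Pi.single β (su2Gen a' * W β)) c * A⁻¹) with hN
  have hN' : Dw V c * A⁻¹ = N := by
    rw [hDV, hN, Finset.sum_mul]
    exact Finset.sum_congr rfl fun a' _ => by rw [Matrix.smul_mul]
  have harg : fderiv ℂ (avgMh : (PBond P j → MatA 2) → PBond P (j + 1) → MatA 2) TW (Pi.single β (su2Gen a * TW β)) c * (avgMh TW c)⁻¹ = g * N * g.adjugate := by
    rw [hresp, hinv, ← hN']
    calc g * Dw V c * ut.adjugate * (ut * A⁻¹ * g.adjugate)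
        = g * Dw V c * (ut.adjugate * ut) * A⁻¹ * g.adjugate := by noncomm_ring
      _ = g * (Dw V c * A⁻¹) * g.adjugate := by rw [adjugate_mul_self_of_det_eq_one (hu _), mul_one]; noncomm_ring
  have hNtr : N.trace = 0 := by
    rw [hN, Matrix.trace_sum]
    refine Finset.sum_eq_zero fun a' _ => ?_
    rw [Matrix.trace_smul, trace_jacResponse_eq_zero W hW h3 c a', smul_zero]
  -- (S7) read in coordinates
  show su2CoordC (fderiv ℂ (avgMh : (PBond P j → MatA 2) → PBond P (j + 1) → MatA 2) TW (Pi.single (centralBond c) (su2Gen a * TW (centralBond c))) c *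
      (avgMh TW c)⁻¹) i = _
  rw [← hβ, harg, su2CoordC_conj_eq_sum g hNtr i]
  refine Finset.sum_congr rfl fun i' _ => ?_
  rw [hN, su2CoordC_sum_smul, Finset.mul_sum]
  refine Finset.sum_congr rfl fun a' _ => ?_
  show su2CoordC (g * su2Gen i' * g.adjugate) i * (cf a' * su2CoordC (Dw (Pi.single β (su2Gen a' * W β)) c * A⁻¹) i') =
    su2CoordC (g * su2Gen i' * g.adjugate) i * jacBlockC c W i' a' * cf a'
  rw [jacBlockC, Matrix.of_apply]
  ring

/-- ★★ **THE COMPLEX BLOCK LAW**: `A₁^ℂ(c)(W^u) = Ad^ℂ(u(emb c₋)) · A₁^ℂ(c)(W) · Ad^ℂ(adj u(b₀(c)₋))`, `Ad^ℂ(g)_{ia} = su2CoordC(g·su2Gen a·adj g)_i`. [cite: Balaban1987RG1, (2.16) p.269, (1.19) p.263, p.267] -/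
theorem jacBlockC_gauge (u : Site P j → MatA 2) (hu : ∀ x, (u x).det = 1) (W : PBond P j → MatA 2) (hW : ∀ b, (W b).det = 1)
    (h3 : ∀ (c : PBond P (j + 1)) (i : Idx P), ‖loopMh W c i - 1‖ < 1 / 3)
    (h' : ∀ (c : PBond P (j + 1)) (i : Idx P), ‖loopMh (fun b : PBond P j => u b.src * W b * (u b.tgt).adjugate) c i - 1‖ < 1) (c : PBond P (j + 1)) :
    jacBlockC c (fun b : PBond P j => u b.src * W b * (u b.tgt).adjugate) =
      (Matrix.of fun i a : Fin 3 => su2CoordC (u (emb c.src) * su2Gen a * (u (emb c.src)).adjugate) i) * jacBlockC c W *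
        (Matrix.of fun i a : Fin 3 => su2CoordC ((u (centralBond c).src).adjugate * su2Gen a * ((u (centralBond c).src).adjugate).adjugate) i) := by
  ext i a
  rw [jacBlockC_gauge_apply u hu W hW h3 h' c i a, Matrix.mul_apply]
  simp only [Matrix.mul_apply, Matrix.of_apply, adjugate_adjugate_two, Finset.sum_mul]
  rw [Finset.sum_comm]

/-- ★★ **THE HOLOMORPHIC JACOBIAN DETERMINANT IS GAUGE INVARIANT**: `det A₁^ℂ(c)(W^u) = det A₁^ℂ(c)(W)` (both complex adjoint matrices have determinant `(det)³ = 1`, ✓p812578 `det_adMatC`).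
[cite: Balaban1987RG1, (1.19) p.263, (2.16) p.269] -/
theorem det_jacBlockC_gauge (u : Site P j → MatA 2) (hu : ∀ x, (u x).det = 1) (W : PBond P j → MatA 2) (hW : ∀ b, (W b).det = 1)
    (h3 : ∀ (c : PBond P (j + 1)) (i : Idx P), ‖loopMh W c i - 1‖ < 1 / 3)
    (h' : ∀ (c : PBond P (j + 1)) (i : Idx P), ‖loopMh (fun b : PBond P j => u b.src * W b * (u b.tgt).adjugate) c i - 1‖ < 1) (c : PBond P (j + 1)) :
    (jacBlockC c (fun b : PBond P j => u b.src * W b * (u b.tgt).adjugate)).det = (jacBlockC c W).det := by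
  rw [jacBlockC_gauge u hu W hW h3 h' c, Matrix.det_mul, Matrix.det_mul, det_adMatC_of_det_eq_one (hu _), one_mul]
  have hdet : ((u (centralBond c).src).adjugate).det = 1 := by rw [Matrix.det_adjugate, hu, one_pow]
  rw [det_adMatC_of_det_eq_one hdet, mul_one]

/-- ★★ **… hence the holomorphic Jacobian factor is gauge invariant**: `jacFactorC c (W^u) = jacFactorC c W` — row (d) ((1.19) for `SL(2,ℂ)`-valued gauge transformations) of `stub_LZjac` on one torus.
[cite: Balaban1987RG1, (1.19) p.263] -/
theorem jacFactorC_gauge (u : Site P j → MatA 2) (hu : ∀ x, (u x).det = 1) (W : PBond P j → MatA 2) (hW : ∀ b, (W b).det = 1)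
    (h3 : ∀ (c : PBond P (j + 1)) (i : Idx P), ‖loopMh W c i - 1‖ < 1 / 3)
    (h' : ∀ (c : PBond P (j + 1)) (i : Idx P), ‖loopMh (fun b : PBond P j => u b.src * W b * (u b.tgt).adjugate) c i - 1‖ < 1) (c : PBond P (j + 1)) :
    jacFactorC c (fun b : PBond P j => u b.src * W b * (u b.tgt).adjugate) = jacFactorC c W := by
  rw [jacFactorC, jacFactorC, det_jacBlockC_gauge u hu W hW h3 h' c]

end Summit.QuantumFields.YangMills.Theorems.BalabanUVNodesPortS1

end
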